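import Summits.MatrixMultiplication.OmegaCensus.STPPVosperDoubleTableLaw

/-!
# ω-census (abelian STPP census): three double Vosper-table kills at `ℤ₆₁` (kernel)

HONEST FRAMING (pub-omega census; verbatim): lottery ticket; floor = certified bounds/negative ranges.
Census STRUCTURE (seat pub-omega-stpp-1 gen 29, 2026-08-28), family (b2).  Applications of the double Vosper table law `no_isSTPP_of_two_tight_tables`
(`STPPVosperDoubleTableLaw.lean`) to the three minimal beating patterns of `ℤ₆₁` with a `(3,3,3)` block that are alive under the python filters of record
N7–N20 (approximate enumeration, HOME `pub-omega-stpp-1-g29/scan/vosper_scan_61_nb3.json`), are N18-tight at the `(3,3,3)` block in the readings `(a,b,c)`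
and `(a,c,b)` with the SAME numerology `(z, b, vol, a, L) = (12, 3, 27, 3, 18)`, and whose single table `(47, 20, 3)` leaves the exceptional ratio `±30`
(`31 ≡ −30`): `{(1,3,3),(3,3,3),(3,3,3)}`, `{(2,2,3),(2,4,3),(3,3,3)}`, `{(2,3,3),(2,3,3),(3,3,3)}` (`Σ aᵢbᵢcᵢ = 63`).  Nothing here is progress on `ω`;
two of the three contain the ENGINE-dead cores `(3,3,3)²` / `(3,3,3)+(2,3,3)` of HOME `pub-omega-stpp-1-g28/fronts/universal-cores-5863.json` — the theorems
make them KERNEL-dead.  Python reading of the table: `code/p6_tables.py` (survivors `{0, 1, 30, 31, 60}`); of the step system: `code/p7_multi.py`.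

References: A. G. Vosper, J. London Math. Soc. 31 (1956); M. B. Nathanson, *Additive Number Theory: Inverse Problems*, GTM 165, Thm 2.7; H. Cohn,
R. Kleinberg, B. Szegedy, C. Umans, FOCS 2005 (arXiv:math/0511460), Def. 5.1.
-/

open Finset
open scoped Pointwise

namespace Summit.MatrixMultiplication.OmegaCensus.CubeNB

open Literature.Computability.AlgebraicComplexity
open Literature.Combinatorics.Additive
open Summit.MatrixMultiplication.OmegaCensus.STPPKneser

/-- Table `(n, m, r) = (47, 20, 3)` with the exceptional ratio: for all `j, t < 61`, the 20 positions `(t + j·i) mod 61` in `[0,47)` with the prefix law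
`3 ∣ pos − #(earlier below)` at each force `j ∈ {0, 1, 60, 30, 31}`. [folklore] -/
theorem table_47_20_3 : ∀ j < 61, ∀ t < 61, (∀ i < 20, (t + j * i) % 61 < 47) →
    (∀ k < 20, 3 ∣ (t + j * k) % 61 - #((range 20).filter fun i => (t + j * i) % 61 < (t + j * k) % 61)) →
    j ∈ ({0, 1, 60, 30, 31} : Finset ℕ) := by
  decide +kernel

/-- The arithmetic of the exceptional ratio: `30 + 31 ≡ 0` and `30 ≢ 0 (mod 61)`. [folklore] -/
theorem c30_c31 : ((30 : ℕ) : ZMod 61) + ((31 : ℕ) : ZMod 61) = 0 ∧ ((30 : ℕ) : ZMod 61) ≠ 0 := by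
  constructor <;> decide

/-- **`{(1,3,3),(3,3,3),(3,3,3)}` has no STPP family in `ℤ₆₁`** (double Vosper table law at a `(3,3,3)` block, table `(47,20,3)` twice).
[cite: CohnKleinbergSzegedyUmans2005, Def. 5.1] [cite: Nathanson1996, Thm 2.7] -/
theorem no_isSTPP_zmod61_133_333_333 (A B C : Fin 3 → Finset (ZMod 61)) (hS : IsSTPP A B C)
    (hA : ∀ i, #(A i) = ![1, 3, 3] i) (hB : ∀ i, #(B i) = ![3, 3, 3] i) (hC : ∀ i, #(C i) = ![3, 3, 3] i) : False := by
  have hAne : ∀ i, (A i).Nonempty := fun i => card_pos.1 (by rw [hA]; fin_cases i <;> simp)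
  have hBne : ∀ i, (B i).Nonempty := fun i => card_pos.1 (by rw [hB]; fin_cases i <;> simp)
  have hCne : ∀ i, (C i).Nonempty := fun i => card_pos.1 (by rw [hC]; fin_cases i <;> simp)
  have e2 : (univ : Finset (Fin 3)).erase 2 = {0, 1} := by decide
  have hz : ∑ k ∈ (univ : Finset (Fin 3)).erase 2, #(A k) * #(C k) = 12 := by
    rw [e2, Finset.sum_pair (by decide)]; simp [hA, hC]
  have hL : ∑ k ∈ (univ : Finset (Fin 3)).erase 2, #(B k) * #(C k) = 18 := by
    rw [e2, Finset.sum_pair (by decide)]; simp [hB, hC]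
  have hz' : ∑ k ∈ (univ : Finset (Fin 3)).erase 2, #(A k) * #(B k) = 12 := by
    rw [e2, Finset.sum_pair (by decide)]; simp [hA, hB]
  have hL' : ∑ k ∈ (univ : Finset (Fin 3)).erase 2, #(C k) * #(B k) = 18 := by
    rw [e2, Finset.sum_pair (by decide)]; simp [hB, hC]
  exact no_isSTPP_of_two_tight_tables A B C hS hAne hBne hCne 2 ⟨0, by decide⟩ (by rw [hA]; simp) (by rw [hB]; simp)
    (by rw [hC]; simp) (show 3 * 3 * 3 = 27 from rfl) hz hL hz' hL' (by norm_num) (by norm_num) (by norm_num) (by norm_num) (by norm_num)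
    (by norm_num) (by norm_num) (by norm_num) (by norm_num) (m := 20) (n := 47) (m' := 20) (n' := 47) rfl rfl rfl rfl c30_c31.1 c30_c31.2
    table_47_20_3 table_47_20_3

/-- **`{(2,2,3),(2,4,3),(3,3,3)}` has no STPP family in `ℤ₆₁`** (double Vosper table law at the `(3,3,3)` block, table `(47,20,3)` twice).
[cite: CohnKleinbergSzegedyUmans2005, Def. 5.1] [cite: Nathanson1996, Thm 2.7] -/
theorem no_isSTPP_zmod61_223_243_333 (A B C : Fin 3 → Finset (ZMod 61)) (hS : IsSTPP A B C)
    (hA : ∀ i, #(A i) = ![2, 2, 3] i) (hB : ∀ i, #(B i) = ![2, 4, 3] i) (hC : ∀ i, #(C i) = ![3, 3, 3] i) : False := by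
  have hAne : ∀ i, (A i).Nonempty := fun i => card_pos.1 (by rw [hA]; fin_cases i <;> simp)
  have hBne : ∀ i, (B i).Nonempty := fun i => card_pos.1 (by rw [hB]; fin_cases i <;> simp)
  have hCne : ∀ i, (C i).Nonempty := fun i => card_pos.1 (by rw [hC]; fin_cases i <;> simp)
  have e2 : (univ : Finset (Fin 3)).erase 2 = {0, 1} := by decide
  have hz : ∑ k ∈ (univ : Finset (Fin 3)).erase 2, #(A k) * #(C k) = 12 := by
    rw [e2, Finset.sum_pair (by decide)]; simp [hA, hC]
  have hL : ∑ k ∈ (univ : Finset (Fin 3)).erase 2, #(B k) * #(C k) = 18 := by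
    rw [e2, Finset.sum_pair (by decide)]; simp [hB, hC]
  have hz' : ∑ k ∈ (univ : Finset (Fin 3)).erase 2, #(A k) * #(B k) = 12 := by
    rw [e2, Finset.sum_pair (by decide)]; simp [hA, hB]
  have hL' : ∑ k ∈ (univ : Finset (Fin 3)).erase 2, #(C k) * #(B k) = 18 := by
    rw [e2, Finset.sum_pair (by decide)]; simp [hB, hC]
  exact no_isSTPP_of_two_tight_tables A B C hS hAne hBne hCne 2 ⟨0, by decide⟩ (by rw [hA]; simp) (by rw [hB]; simp)
    (by rw [hC]; simp) (show 3 * 3 * 3 = 27 from rfl) hz hL hz' hL' (by norm_num) (by norm_num) (by norm_num) (by norm_num) (by norm_num)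
    (by norm_num) (by norm_num) (by norm_num) (by norm_num) (m := 20) (n := 47) (m' := 20) (n' := 47) rfl rfl rfl rfl c30_c31.1 c30_c31.2
    table_47_20_3 table_47_20_3

/-- **`{(2,3,3),(2,3,3),(3,3,3)}` has no STPP family in `ℤ₆₁`** (double Vosper table law at the `(3,3,3)` block, table `(47,20,3)` twice).
[cite: CohnKleinbergSzegedyUmans2005, Def. 5.1] [cite: Nathanson1996, Thm 2.7] -/
theorem no_isSTPP_zmod61_233_233_333 (A B C : Fin 3 → Finset (ZMod 61)) (hS : IsSTPP A B C)
    (hA : ∀ i, #(A i) = ![2, 2, 3] i) (hB : ∀ i, #(B i) = ![3, 3, 3] i) (hC : ∀ i, #(C i) = ![3, 3, 3] i) : False := by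
  have hAne : ∀ i, (A i).Nonempty := fun i => card_pos.1 (by rw [hA]; fin_cases i <;> simp)
  have hBne : ∀ i, (B i).Nonempty := fun i => card_pos.1 (by rw [hB]; fin_cases i <;> simp)
  have hCne : ∀ i, (C i).Nonempty := fun i => card_pos.1 (by rw [hC]; fin_cases i <;> simp)
  have e2 : (univ : Finset (Fin 3)).erase 2 = {0, 1} := by decide
  have hz : ∑ k ∈ (univ : Finset (Fin 3)).erase 2, #(A k) * #(C k) = 12 := by
    rw [e2, Finset.sum_pair (by decide)]; simp [hA, hC]
  have hL : ∑ k ∈ (univ : Finset (Fin 3)).erase 2, #(B k) * #(C k) = 18 := by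
    rw [e2, Finset.sum_pair (by decide)]; simp [hB, hC]
  have hz' : ∑ k ∈ (univ : Finset (Fin 3)).erase 2, #(A k) * #(B k) = 12 := by
    rw [e2, Finset.sum_pair (by decide)]; simp [hA, hB]
  have hL' : ∑ k ∈ (univ : Finset (Fin 3)).erase 2, #(C k) * #(B k) = 18 := by
    rw [e2, Finset.sum_pair (by decide)]; simp [hB, hC]
  exact no_isSTPP_of_two_tight_tables A B C hS hAne hBne hCne 2 ⟨0, by decide⟩ (by rw [hA]; simp) (by rw [hB]; simp)
    (by rw [hC]; simp) (show 3 * 3 * 3 = 27 from rfl) hz hL hz' hL' (by norm_num) (by norm_num) (by norm_num) (by norm_num) (by norm_num)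
    (by norm_num) (by norm_num) (by norm_num) (by norm_num) (m := 20) (n := 47) (m' := 20) (n' := 47) rfl rfl rfl rfl c30_c31.1 c30_c31.2
    table_47_20_3 table_47_20_3

end Summit.MatrixMultiplication.OmegaCensus.CubeNB
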